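import Mathlib
import HarnessLib
import Literature.Probability.Percolation.Percolation
import Summits.CriticalPhenomena.PercolationContinuityZ3.Theorems.PercNearOneGluingNoHeavyLowerTailAntipodalCutVertexGraph

/-!
# Anchored complementation and ROW P: the fibrewise SPLIT inequality with pendant T-terminals

Helper file for crux `stmt-CriticalPhenomena-4575` (`NoHeavyLowerTail`, route `PercNearOneGluingNoHeavy`),
new-inequality factory seat `prim-ineq-gen-1` (gen 9).  Everything here is PROVED; no route definition is touched.
Memo: `run/shared/lean/prim/prim-ineq-gen-1/FINDING-15-junctions-and-two-sided-nogos.md` §10 (THEOREM P).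

Setting (as in `…AntipodalCutVertexGraph.lean`): a multigraph is given by a vertex type `V`, fixed open edges
`F ⊆ Sym2 V` (open in BOTH colours: the contracted part of an interval) and free edges labelled by a finite type
`ι` through `e : ι → Sym2 V` (labels need not be injective).  A colouring is `X : Finset ι`; its red configuration is
`F ∪ e '' X`, its blue configuration `F ∪ e '' Xᶜ`; `openGraph ω` is `SimpleGraph.fromEdgeSet ω`
(`Literature.Probability.Percolation`).

**The anchored-complementation involution.**  Fix a vertex `w₁`.  For a colouring `X` let `R(X)` be the red cluster
of `w₁` (vertices red-reachable from `w₁`) and let `Ψ(X)` complement the colour of every FREE edge none of whose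
endpoints lies in `R(X)`.  Then (`anchor_reach_iff`) `R(Ψ X) = R(X)`, so `Ψ` is an involution (`psi_psi`); red paths
from a vertex outside `R` in `Ψ X` are blue paths of `X` (`red_psi_to_blue`), and red paths of `X` between vertices
outside `R` are blue in `Ψ X` (`red_to_blue_psi`).

**ROW P** (`rowP_card_le`).  For all vertices `a v w₁ w₂`:
`#{X : a ~_red v, w₁ ~_red w₂, a ≁_red w₁, a ≁_blue v} ≤ #{X : a ≁_red v, w₁ ~_red w₂, a ≁_red w₁, v ≁_red w₁, a ~_blue v}`,
i.e. `#{red partition = av|w₁w₂ on the four points, blue does not join a,v} ≤ #{red partition = a|v|w₁w₂, blue joins a,v}`.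
This is exactly the fibrewise SPLIT inequality T2 (`A ≤ B`, see `…AntipodalSplitForms.lean`) for every multigraph whose
second terminal pair `b, c` is PENDANT (`b` attached by one free edge to `w₁`, `c` by one free edge to `w₂`, after summing
out the two pendant edges; FINDING-15 §2/§10), an infinite class with a genuine 2-vertex interface; it is a valid linear
row on 4-point antipodal partition tables that lies OUTSIDE the cone of submodular-kernel rows (kit j094349).  Proof:
`X ↦ Ψ X` maps the left set injectively into the right set.  (Found and proved by this seat, 2026-08-20.)
-/

namespace Summit.CriticalPhenomena.PercolationContinuityZ3.Theorems

namespace AnchoredComplement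

open Finset Literature.Probability.Percolation AntipodalCutVertex

variable {V : Type*} {ι : Type*} [DecidableEq ι] [Fintype ι]

/-- The red configuration of the colouring `X`: fixed edges and the free edges labelled in `X`. [this work] -/
def red (F : Set (Sym2 V)) (e : ι → Sym2 V) (X : Finset ι) : Set (Sym2 V) := F ∪ e '' (↑X : Set ι)

/-- The red cluster of the anchor `w₁`. [this work] -/
def anchor (F : Set (Sym2 V)) (e : ι → Sym2 V) (w₁ : V) (X : Finset ι) : Set V :=
  {y | (openGraph (red F e X)).Reachable w₁ y}

open scoped Classical in
/-- The free edges far from the anchor cluster (no endpoint in it). [this work] -/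
noncomputable def far (F : Set (Sym2 V)) (e : ι → Sym2 V) (w₁ : V) (X : Finset ι) : Finset ι :=
  Finset.univ.filter (fun i => ∀ y ∈ e i, y ∉ anchor F e w₁ X)

/-- Anchored complementation: flip every free edge far from the red cluster of `w₁`. [this work] -/
noncomputable def psi (F : Set (Sym2 V)) (e : ι → Sym2 V) (w₁ : V) (X : Finset ι) : Finset ι :=
  symmDiff X (far F e w₁ X)

section

variable (F : Set (Sym2 V)) (e : ι → Sym2 V) (w₁ : V)

/-- A free edge with an endpoint in the anchor cluster keeps its colour under `Ψ`. [this work] -/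
theorem mem_psi_iff_of_touch {X : Finset ι} {i : ι} {y : V} (hy : y ∈ e i) (hyR : y ∈ anchor F e w₁ X) :
    i ∈ psi F e w₁ X ↔ i ∈ X := by
  have hfar : i ∉ far F e w₁ X := by
    intro h
    simp only [far, Finset.mem_filter, Finset.mem_univ, true_and] at h
    exact h y hy hyR
  simp [psi, Finset.mem_symmDiff, hfar]

/-- A far free edge (no endpoint in the anchor cluster) changes colour under `Ψ`. [this work] -/
theorem mem_psi_iff_of_far {X : Finset ι} {i : ι} (hfar : ∀ y ∈ e i, y ∉ anchor F e w₁ X) :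
    i ∈ psi F e w₁ X ↔ i ∉ X := by
  have h : i ∈ far F e w₁ X := by
    simp only [far, Finset.mem_filter, Finset.mem_univ, true_and]
    exact hfar
  simp [psi, Finset.mem_symmDiff, h]

omit [DecidableEq ι] [Fintype ι] in
/-- The anchor cluster is closed under red edges. [this work] -/
theorem anchor_step {X : Finset ι} {p q : V} (hp : p ∈ anchor F e w₁ X) (hpq : s(p, q) ∈ red F e X) :
    q ∈ anchor F e w₁ X :=
  SimpleGraph.Reachable.trans hp (reachable_of_mem hpq)

/-- A red edge of `X` at a vertex of the anchor cluster is still red in `Ψ X`. [this work] -/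
theorem red_psi_of_red_touch {X : Finset ι} {p q : V} (hp : p ∈ anchor F e w₁ X)
    (hpq : s(p, q) ∈ red F e X) : s(p, q) ∈ red F e (psi F e w₁ X) := by
  rcases hpq with h | ⟨i, hi, he⟩
  · exact Or.inl h
  · refine Or.inr ⟨i, ?_, he⟩
    rw [Finset.mem_coe, mem_psi_iff_of_touch F e w₁ (i := i) (y := p) (by rw [he]; exact Sym2.mem_mk_left p q) hp]
    exact hi

/-- A red edge of `Ψ X` at a vertex of the anchor cluster of `X` was red in `X`. [this work] -/
theorem red_of_red_psi_touch {X : Finset ι} {p q : V} (hp : p ∈ anchor F e w₁ X)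
    (hpq : s(p, q) ∈ red F e (psi F e w₁ X)) : s(p, q) ∈ red F e X := by
  rcases hpq with h | ⟨i, hi, he⟩
  · exact Or.inl h
  · refine Or.inr ⟨i, ?_, he⟩
    rw [Finset.mem_coe] at hi ⊢
    exact (mem_psi_iff_of_touch F e w₁ (i := i) (y := p) (by rw [he]; exact Sym2.mem_mk_left p q) hp).mp hi

/-- **The anchor cluster is invariant under `Ψ`.** [this work] -/
theorem anchor_reach_iff (X : Finset ι) (y : V) :
    y ∈ anchor F e w₁ (psi F e w₁ X) ↔ y ∈ anchor F e w₁ X := by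
  constructor
  · intro h
    change (openGraph (red F e (psi F e w₁ X))).Reachable w₁ y at h
    rw [reachable_iff] at h
    induction h with
    | refl => exact SimpleGraph.Reachable.refl w₁
    | @tail p q _ hpq ih => exact anchor_step F e w₁ ih (red_of_red_psi_touch F e w₁ ih hpq)
  · intro h
    change (openGraph (red F e X)).Reachable w₁ y at h
    rw [reachable_iff] at h
    induction h with
    | refl => exact SimpleGraph.Reachable.refl w₁
    | @tail p q _ hpq ih =>
      -- ih : q? no: ih is about p; we need p ∈ anchor X too, recover it from ih via the converse direction? use both
      have hpX : p ∈ anchor F e w₁ X := by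
        change (openGraph (red F e X)).Reachable w₁ p
        rw [reachable_iff]; assumption
      exact SimpleGraph.Reachable.trans ih (reachable_of_mem (red_psi_of_red_touch F e w₁ hpX hpq))

/-- The far set is the same for `X` and `Ψ X`. [this work] -/
theorem far_psi (X : Finset ι) : far F e w₁ (psi F e w₁ X) = far F e w₁ X := by
  ext i
  simp only [far, Finset.mem_filter, Finset.mem_univ, true_and, anchor_reach_iff]

/-- **`Ψ` is an involution.** [this work] -/
theorem psi_psi (X : Finset ι) : psi F e w₁ (psi F e w₁ X) = X := by
  rw [psi, far_psi, psi, symmDiff_assoc, symmDiff_self, symmDiff_bot]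

omit [DecidableEq ι] [Fintype ι] in
/-- A vertex red-joined to a vertex outside the anchor cluster is outside the anchor cluster. [this work] -/
theorem not_mem_anchor_of_reach {X : Finset ι} {p q : V} (hp : p ∉ anchor F e w₁ X)
    (hpq : (openGraph (red F e X)).Reachable p q) : q ∉ anchor F e w₁ X :=
  fun hq => hp (SimpleGraph.Reachable.trans hq hpq.symm)

/-- Red paths of `X` from a vertex outside the anchor cluster become blue paths of `Ψ X`. [this work] -/
theorem red_to_blue_psi {X : Finset ι} {p q : V} (hp : p ∉ anchor F e w₁ X)
    (h : (openGraph (red F e X)).Reachable p q) : (openGraph (red F e (psi F e w₁ X)ᶜ)).Reachable p q := by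
  rw [reachable_iff] at h
  induction h with
  | refl => exact SimpleGraph.Reachable.refl p
  | @tail x y hx hxy ih =>
    have hxR : x ∉ anchor F e w₁ X := not_mem_anchor_of_reach F e w₁ hp ((reachable_iff _ p x).mpr hx)
    have hyR : y ∉ anchor F e w₁ X :=
      not_mem_anchor_of_reach F e w₁ hp (((reachable_iff _ p x).mpr hx).trans (reachable_of_mem hxy))
    refine ih.trans (reachable_of_mem ?_)
    rcases hxy with h | ⟨i, hi, he⟩
    · exact Or.inl h
    · refine Or.inr ⟨i, ?_, he⟩
      have hfar : ∀ z ∈ e i, z ∉ anchor F e w₁ X := by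
        intro z hz
        rw [he] at hz
        rcases Sym2.mem_iff.mp hz with rfl | rfl
        · exact hxR
        · exact hyR
      rw [Finset.mem_coe, Finset.mem_compl, mem_psi_iff_of_far F e w₁ hfar, not_not]
      exact hi

/-- Red paths of `Ψ X` from a vertex outside the anchor cluster were blue paths of `X`. [this work] -/
theorem red_psi_to_blue {X : Finset ι} {p q : V} (hp : p ∉ anchor F e w₁ X)
    (h : (openGraph (red F e (psi F e w₁ X))).Reachable p q) : (openGraph (red F e Xᶜ)).Reachable p q := by
  have hp' : p ∉ anchor F e w₁ (psi F e w₁ X) := by rwa [anchor_reach_iff]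
  have h2 := red_to_blue_psi F e w₁ (X := psi F e w₁ X) hp' h
  rwa [psi_psi] at h2

end

open scoped Classical in
/-- **ROW P** (THEOREM P of FINDING-15): for every multigraph (fixed edges `F`, free edges `e : ι → Sym2 V`) and all
vertices `a v w₁ w₂`,
`#{X : red = av|w₁w₂ on the four points, a ≁_blue v} ≤ #{X : red = a|v|w₁w₂, a ~_blue v}`
(red `= F ∪ e(X)`, blue `= F ∪ e(Xᶜ)`).  Equivalently, the fibrewise SPLIT inequality `A ≤ B` holds for every multigraph
whose terminals `b, c` are pendant at `w₁, w₂`.  The map `X ↦ Ψ X` (complement the free edges far from the red cluster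
of `w₁`) is an injection from the left set into the right set. [new] -/
theorem rowP_card_le (F : Set (Sym2 V)) (e : ι → Sym2 V) (a v w₁ w₂ : V) :
    (Finset.univ.filter (fun X : Finset ι =>
        (openGraph (red F e X)).Reachable a v ∧ (openGraph (red F e X)).Reachable w₁ w₂ ∧
          ¬ (openGraph (red F e X)).Reachable w₁ a ∧ ¬ (openGraph (red F e Xᶜ)).Reachable a v)).card ≤
      (Finset.univ.filter (fun X : Finset ι =>
        ¬ (openGraph (red F e X)).Reachable a v ∧ (openGraph (red F e X)).Reachable w₁ w₂ ∧
          ¬ (openGraph (red F e X)).Reachable w₁ a ∧ ¬ (openGraph (red F e X)).Reachable w₁ v ∧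
          (openGraph (red F e Xᶜ)).Reachable a v)).card := by
  refine Finset.card_le_card_of_injOn (psi F e w₁) ?_ ?_
  · intro X hX
    rw [Finset.mem_coe, Finset.mem_filter] at hX ⊢
    obtain ⟨-, hav, hww, hwa, hnb⟩ := hX
    have haR : a ∉ anchor F e w₁ X := hwa
    have hvR : v ∉ anchor F e w₁ X := not_mem_anchor_of_reach F e w₁ haR hav
    refine ⟨Finset.mem_univ _, ?_, ?_, ?_, ?_, ?_⟩
    · -- a ≁_red v in Ψ X: otherwise a ~_blue v in X
      intro h
      exact hnb (red_psi_to_blue F e w₁ haR h)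
    · -- w₁ ~_red w₂ is preserved (anchor cluster invariant)
      exact (anchor_reach_iff F e w₁ X w₂).mpr hww
    · exact fun h => haR ((anchor_reach_iff F e w₁ X a).mp h)
    · exact fun h => hvR ((anchor_reach_iff F e w₁ X v).mp h)
    · -- the old red a–v path is blue in Ψ X
      exact red_to_blue_psi F e w₁ haR hav
  · intro X _ X' _ h
    have := congrArg (psi F e w₁) h
    rwa [psi_psi, psi_psi] at this

open scoped Classical in
/-- **ROW W′** (FINDING-15 §11): for every multigraph and all vertices `a v w₁ w₂`,
`#{X : w₁ ~_red w₂, w₁ ≁_red a, w₁ ≁_red v, a ~_red v} ≤ #{X : w₁ ~_red w₂, w₁ ≁_red a, w₁ ≁_red v, a ~_blue v}`: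
given that the red cluster of `w₁` contains `w₂` and avoids `a, v`, the pair `a, v` is at least as often blue-joined as
red-joined (a red `a`–`v` path is far from that cluster and becomes blue under `Ψ`).  In the `W3`-gadget dissection of
FINDING-15 §11 this is the theorem part `W′ = Σ α·[w₁~_B w₂][w₁,w₂ ≁_B S] ≥ 0` (after the colour swap). [new] -/
theorem rowW_card_le (F : Set (Sym2 V)) (e : ι → Sym2 V) (a v w₁ w₂ : V) :
    (Finset.univ.filter (fun X : Finset ι =>
        (openGraph (red F e X)).Reachable w₁ w₂ ∧ ¬ (openGraph (red F e X)).Reachable w₁ a ∧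
          ¬ (openGraph (red F e X)).Reachable w₁ v ∧ (openGraph (red F e X)).Reachable a v)).card ≤
      (Finset.univ.filter (fun X : Finset ι =>
        (openGraph (red F e X)).Reachable w₁ w₂ ∧ ¬ (openGraph (red F e X)).Reachable w₁ a ∧
          ¬ (openGraph (red F e X)).Reachable w₁ v ∧ (openGraph (red F e Xᶜ)).Reachable a v)).card := by
  refine Finset.card_le_card_of_injOn (psi F e w₁) ?_ ?_
  · intro X hX
    rw [Finset.mem_coe, Finset.mem_filter] at hX ⊢
    obtain ⟨-, hww, hwa, hwv, hav⟩ := hX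
    have haR : a ∉ anchor F e w₁ X := hwa
    refine ⟨Finset.mem_univ _, ?_, ?_, ?_, ?_⟩
    · exact (anchor_reach_iff F e w₁ X w₂).mpr hww
    · exact fun h => hwa ((anchor_reach_iff F e w₁ X a).mp h)
    · exact fun h => hwv ((anchor_reach_iff F e w₁ X v).mp h)
    · exact red_to_blue_psi F e w₁ haR hav
  · intro X _ X' _ h
    have := congrArg (psi F e w₁) h
    rwa [psi_psi, psi_psi] at this

end AnchoredComplement

end Summit.CriticalPhenomena.PercolationContinuityZ3.Theorems
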